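import Mathlib
import Summits.NavierStokesRegularity.NavierStokesRegularity.Theorems.TaoLadderRungTwoBreakOneShiftFrameClosedForm
import Summits.NavierStokesRegularity.NavierStokesRegularity.Theorems.TaoLadderRungTwoBreakOneShiftCentre
import HarnessLib

/-!
# The one-shift Banach argument on the closed-form frame from ONE hull of the renormalisation factor

`exists_surviving_dssWave_of_windowCert_v6` (…OneShiftFrameClosedForm) takes four certificate-side statements
about the renormalisation factor `g = (Σ_i z_{i,1}(τ)²)^{-1/2}` of the window run and about the invariant set:
`hg0` (`0 ≤ g ≤ g_hi`), `hη` (`|g - ĝ| ≤ η`), `hg` (`1 < g² ≤ 1+ε₀`, `g < Λ`, `β² < gΛ`) and `h0` (the invariant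
set is non-empty).  `exists_surviving_dssWave_of_windowCert_v7` replaces them by the single two-sided hull
`hgl : g_lo ≤ g ≤ g_hi` over the admissible set (one line of the engine's certificate) plus the scalar
conditions `1 < g_lo`, `g_hi² ≤ 1+ε₀`, `g_hi < Λ`, `β² < g_lo Λ`, `g_lo ≤ ĝ ≤ g_hi` (so `η = max(g_hi-ĝ, ĝ-g_lo)`),
and discharges `h0` by the centre point (`exists_admLip`).  Model lattice only (Tao-type averaged cascade);
nothing here is about Navier–Stokes.
[cite: Tao2016AveragedNS, §4 Lemma 4.1, §5.3–§6; cell vocabulary, harvest/h2-tao-ladder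
rung1/KERNEL-STAGE3-PLAN.md §6, rung1/INSTANCE-SHEET-T4-0.1-W76.md (rows `hg0, hg, h0`)]
-/

noncomputable section

namespace Summit.NavierStokesRegularity.NavierStokesRegularity.Theorems

namespace DSSOneShift

open Set MeasureTheory intervalIntegral
open Literature.Analysis.FluidPDE Literature.Analysis.FluidPDE.TaoCascade CertificateGlueOn

variable {m : ℕ}

namespace OneShiftFrame

variable (F : OneShiftFrame m)

/-- **The one-shift Banach argument on the closed-form frame, from one hull of `g`.**  As
`exists_surviving_dssWave_of_windowCert_v6`, with its four certificate-side statements about the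
renormalisation factor and the invariant set (`hg0, hη, hg, h0`) replaced by the single hull
`hgl : g_lo ≤ g ≤ g_hi` over the admissible set and the scalar conditions `1 < g_lo`, `g_hi² ≤ 1 + ε₀`,
`g_hi < Λ`, `β² < g_lo Λ`, `g_lo ≤ ĝ ≤ g_hi`; the centre-deviation hull is `η = max (g_hi - ĝ) (ĝ - g_lo)` and the
invariant set is non-empty by `exists_admLip`.  What remains certificate-side: the window certificate `cert`,
the edge-form Lipschitz numbers `hWedge/hγedge/hZedge/hDedge`, the Krawczyk inclusion `hwinIn`, the window
amplitude hulls `hAwin`, the hull `hgl`, the wake-entry deviation `hA1`; frame-side: the closed-form equalities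
and scalar inequalities; and the seven rows `hfirstW, hfirstWS, hfirstT, hfirstTS, hrowB, hrowT, hrow1`.
Conditional glue for the Tao-type shell model only; nothing about Navier–Stokes.
[cite: Tao2016AveragedNS, §4 Lemma 4.1 (4.8), §5.3–§6; cell vocabulary, harvest/h2-tao-ladder
rung1/KERNEL-STAGE3-PLAN.md §6, rung1/STAGE3-BANACH.md §1–§2, rung1/INSTANCE-SHEET-T4-0.1-W76.md] -/
theorem exists_surviving_dssWave_of_windowCert_v7 {ε₀ Mα Q β q gLo gHi A1 : ℝ}
    {Z Sb Se γx γb γe dz0 χb χe : ℝ}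
    {ω θ κ ωt ϑ abart ϑR εR ghat cmax r₀ δ' : ℝ} {c₀ : Fin m → ℝ}
    {α : Fin m → Fin m → Fin m → ℤ × ℤ × ℤ → ℝ} (cert : OneShiftWindowCert F ε₀ α)
    (R A vmax χbm χem : ℤ → ℝ)
    (hε : 0 < 1 + ε₀) (hΛ1 : 1 ≤ bigLam ε₀) (hMα : 0 ≤ Mα) (hα : ∀ i₁ i₂ i₃ μ, |α i₁ i₂ i₃ μ| ≤ Mα)
    (hW1 : 1 ≤ F.W) (hq : 0 ≤ q) (hq1 : q < 1) (hA0 : ∀ k, 0 ≤ A k)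
    (hAwin : ∀ w, F.Adm w → ∀ j k', F.InWindow k' → ∀ s ∈ Icc 0 F.τhi, |F.fullFamily cert w j k' s| ≤ A k')
    -- the rate function IS the four-shift bilinear bound
    (hRdef : ∀ k : ℤ, R k = (m : ℝ) ^ 2 * Mα * ((1 + ε₀) ^ ((5 : ℝ) * k / 2) * (A k * A k + 2 * (A k * A (k + 1))) +
        (1 + ε₀) ^ ((5 : ℝ) * ((k : ℝ) - 1) / 2) * (A (k - 1) * A (k - 1))))
    -- ONE two-sided hull of the renormalisation factor over the admissible set, and scalar conditions on it
    (hgl : ∀ w, F.Adm w → gLo ≤ gfac (slice (F.fullFamily cert w) (F.decodeTau w)) ∧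
      gfac (slice (F.fullFamily cert w) (F.decodeTau w)) ≤ gHi)
    (hgLo1 : 1 < gLo) (hgHi2 : gHi ^ 2 ≤ 1 + ε₀) (hgHiΛ : gHi < bigLam ε₀) (hβgLo : β ^ 2 < gLo * bigLam ε₀)
    (hĝlo : gLo ≤ ghat) (hĝgHi : ghat ≤ gHi)
    -- window side, EDGE FORM (the engine's STAGE3 lines)
    (hWedge : ∀ u v, F.AdmLip R u → F.AdmLip R v → ∀ B E : ℝ,
      (∀ i, ∀ t ∈ Icc 0 F.τhi, |F.decodeTail u i (-1) t - F.decodeTail v i (-1) t| ≤ B) →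
      (∀ i, ∀ t ∈ Icc 0 F.τhi, |F.decodeTail u i F.W t - F.decodeTail v i F.W t| ≤ E) →
        dist (F.rawWindow cert u) (F.rawWindow cert v) ≤ Z * dist u v + Sb * B + Se * E)
    (hγedge : ∀ u v, F.AdmLip R u → F.AdmLip R v → ∀ B E : ℝ,
      (∀ i, ∀ t ∈ Icc 0 F.τhi, |F.decodeTail u i (-1) t - F.decodeTail v i (-1) t| ≤ B) →
      (∀ i, ∀ t ∈ Icc 0 F.τhi, |F.decodeTail u i F.W t - F.decodeTail v i F.W t| ≤ E) →
        |gfac (slice (F.fullFamily cert u) (F.decodeTau u)) -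
          gfac (slice (F.fullFamily cert v) (F.decodeTau v))| ≤ γx * dist u v + γb * B + γe * E)
    (hZedge : ∀ u v, F.AdmLip R u → F.AdmLip R v → ∀ i, ∀ B E : ℝ,
      (∀ i, ∀ t ∈ Icc 0 F.τhi, |F.decodeTail u i (-1) t - F.decodeTail v i (-1) t| ≤ B) →
      (∀ i, ∀ t ∈ Icc 0 F.τhi, |F.decodeTail u i F.W t - F.decodeTail v i F.W t| ≤ E) →
        |F.fullFamily cert u i 0 (F.decodeTau u) - F.fullFamily cert v i 0 (F.decodeTau v)| ≤
          dz0 * dist u v + χb * B + χe * E)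
    (hDedge : ∀ u v, F.AdmLip R u → F.AdmLip R v → ∀ j k', F.InWindow k' → ∀ s ∈ Icc 0 F.τhi, ∀ B E : ℝ,
      (∀ i, ∀ t ∈ Icc 0 F.τhi, |F.decodeTail u i (-1) t - F.decodeTail v i (-1) t| ≤ B) →
      (∀ i, ∀ t ∈ Icc 0 F.τhi, |F.decodeTail u i F.W t - F.decodeTail v i F.W t| ≤ E) →
        |F.fullFamily cert u j k' s - F.fullFamily cert v j k' s| ≤ vmax k' * dist u v + χbm k' * B + χem k' * E)
    (hqX : Z + Sb * F.wt (-1) + Se * F.wt F.W ≤ q)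
    (hDwin0 : ∀ k', F.InWindow k' → 0 ≤ vmax k' + χbm k' * F.wt (-1) + χem k' * F.wt F.W)
    (hγ0 : 0 ≤ γx + γb * F.wt (-1) + γe * F.wt F.W)
    -- the closed-form frame: wake side
    (hθ : 1 ≤ θ) (hβ1 : 1 ≤ β) (hβθ : β ≤ θ) (hβΛ : β ≤ bigLam ε₀) (hω : 0 ≤ ω)
    (hδ' : 0 < δ') (hβge : gHi * (1 + δ') ≤ β) (hr₀ : 0 ≤ r₀) (hκ : 0 ≤ κ) (hc : ∀ i, |c₀ i| ≤ cmax)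
    (hQ : cmax + r₀ + κ / δ' ≤ Q) (hσξ : β ^ 2 * (bigLam ε₀)⁻¹ ≤ gHi)
    (hwtW : ∀ n : ℕ, F.wt (-(n : ℤ) - 1) = ω * θ ^ (n + 1))
    (htubeRW : ∀ n : ℕ, F.tubeR (-(n : ℤ) - 1) = gHi ^ (n + 1) * (r₀ + κ * ((n : ℝ) + 1)))
    (htubeCW : ∀ i (n : ℕ), F.tubeC i (-(n : ℤ) - 1) = ghat ^ (n + 1) * c₀ i)
    (hAW : ∀ n : ℕ, A (-(n : ℤ) - 1) = Q * β ^ (n + 1))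
    -- the closed-form frame: above the window
    (hϑ0 : 0 < ϑ) (hϑ1 : ϑ ≤ 1) (hϑR : 0 < ϑR) (hϑRϑ : ϑR ≤ ϑ) (hϑRΛ : ϑR * bigLam ε₀ < 1) (hωt : 0 ≤ ωt)
    (hAlast : A ((F.W : ℤ) - 1) ≤ abart) (hεab : εR ≤ abart * ϑR)
    (hwtT : ∀ j : ℕ, F.wt ((F.W : ℤ) + j) = ωt * ϑ ^ j)
    (htubeRT : ∀ j : ℕ, F.tubeR ((F.W : ℤ) + j) = εR * ϑR ^ j)
    (htubeCT : ∀ i (j : ℕ), F.tubeC i ((F.W : ℤ) + j) = 0)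
    (hAT : ∀ j : ℕ, A ((F.W : ℤ) + j) = εR * ϑR ^ j)
    -- the seven rows
    (hfirstW : ∀ i, gHi * (ω * θ + (4 * (m : ℝ) ^ 2 * Mα * Q ^ 2 * β ^ 2) * (β ^ 2 * (bigLam ε₀)⁻¹) * F.rτ) +
      Q * β * (γx + γb * F.wt (-1) + γe * F.wt F.W) +
      F.τhi * (2 * tableAbsSum α i * (bigLam ε₀)⁻¹ ^ 2 * (ω * θ ^ 3) * (Q * β ^ 3)) ≤ q * (ω * θ ^ 2))
    (hfirstWS : cmax * max (gHi - ghat) (ghat - gLo) * ghat +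
      F.τhi * ((4 * (m : ℝ) ^ 2 * Mα * Q ^ 2 * β ^ 2) * (β ^ 2 * (bigLam ε₀)⁻¹) ^ 2) ≤ κ * gHi ^ 2)
    (hfirstT : ∀ i, gHi * (ωt * ϑ ^ 2 +
        (4 * (m : ℝ) ^ 2 * Mα * abart ^ 2 * bigLam ε₀ ^ F.W) * (bigLam ε₀ * ϑR ^ 2) ^ 2 * F.rτ) +
      (abart * ϑR) * ϑR ^ 2 * (γx + γb * F.wt (-1) + γe * F.wt F.W) +
      F.τhi * (2 * tableAbsSum α i * bigLam ε₀ ^ (F.W + 1) * ωt * (abart * ϑR)) ≤ q * (ωt * ϑ))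
    (hfirstTS : gHi * (εR * ϑR) + F.τhi * (4 * (m : ℝ) ^ 2 * Mα * abart ^ 2 * bigLam ε₀ ^ F.W) ≤ εR)
    (hrowB : ∀ i, gHi * (dz0 + χb * F.wt (-1) + χe * F.wt F.W) + A 0 * (γx + γb * F.wt (-1) + γe * F.wt F.W) +
      F.τhi * quadTermLip ε₀ α A
        (fun k' => if F.InWindow k' then vmax k' + χbm k' * F.wt (-1) + χem k' * F.wt F.W else F.wt k') i (-1) ≤
        q * F.wt (-1))
    (hrowT : ∀ i, gHi * (F.wt ((F.W : ℤ) + 1) + R ((F.W : ℤ) + 1) * F.rτ) +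
      A ((F.W : ℤ) + 1) * (γx + γb * F.wt (-1) + γe * F.wt F.W) +
      F.τhi * quadTermLip ε₀ α A
        (fun k' => if F.InWindow k' then vmax k' + χbm k' * F.wt (-1) + χem k' * F.wt F.W else F.wt k') i F.W ≤
        q * F.wt F.W)
    (hrow1 : A1 + F.τhi * R (-1) ≤ F.tubeR (-1))
    -- the rest as in `v4` / `v5` / `v6`
    (hwinIn : ∀ u, F.AdmLip R u →
      (∀ i k, |(F.rawWindow cert u).1 i k| ≤ 1) ∧ |(F.rawWindow cert u).2| ≤ 1)
    (hA1 : ∀ w, F.Adm w → ∀ i,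
      |gfac (slice (F.fullFamily cert w) (F.decodeTau w)) * F.fullFamily cert w i 0 (F.decodeTau w) -
        F.tubeC i (-1)| ≤ A1)
    (hQA : A 0 ≤ Q) (hne : ∃ i, F.a i 0 < |F.yc i 0|) :
    ∃ (T : ℝ) (Φ : Unit → ℝ → Em m), 0 < T ∧ IsDSSWave ε₀ α (Equiv.refl Unit) T Φ ∧ Surviving 1 ε₀ T ∧
      ∃ x, Φ () x ≠ 0 := by
  have hΛpos : 0 < bigLam ε₀ := lt_of_lt_of_le one_pos hΛ1
  have hgLo0 : 0 ≤ gLo := by linarith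
  have hĝ0 : 0 < ghat := by linarith
  have hg0 : ∀ w, F.Adm w → 0 ≤ gfac (slice (F.fullFamily cert w) (F.decodeTau w)) ∧
      gfac (slice (F.fullFamily cert w) (F.decodeTau w)) ≤ gHi :=
    fun w hw => ⟨hgLo0.trans (hgl w hw).1, (hgl w hw).2⟩
  have hη : ∀ w, F.Adm w →
      |gfac (slice (F.fullFamily cert w) (F.decodeTau w)) - ghat| ≤ max (gHi - ghat) (ghat - gLo) := by
    intro w hw
    obtain ⟨h1, h2⟩ := hgl w hw
    have hl := le_max_left (gHi - ghat) (ghat - gLo)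
    have hr := le_max_right (gHi - ghat) (ghat - gLo)
    rw [abs_le]
    constructor <;> linarith
  have hg : ∀ u, F.AdmLip R u →
      1 < gfac (slice (F.fullFamily cert u) (F.decodeTau u)) ^ 2 ∧
        gfac (slice (F.fullFamily cert u) (F.decodeTau u)) ^ 2 ≤ 1 + ε₀ ∧
        gfac (slice (F.fullFamily cert u) (F.decodeTau u)) < bigLam ε₀ ∧
        β ^ 2 < gfac (slice (F.fullFamily cert u) (F.decodeTau u)) * bigLam ε₀ := by
    intro u hu
    obtain ⟨h1, h2⟩ := hgl u hu.1
    have hgpos : 0 ≤ gfac (slice (F.fullFamily cert u) (F.decodeTau u)) := hgLo0.trans h1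
    refine ⟨by nlinarith, (pow_le_pow_left₀ hgpos h2 2).trans hgHi2, lt_of_le_of_lt h2 hgHiΛ,
      hβgLo.trans_le (mul_le_mul_of_nonneg_right h1 hΛpos.le)⟩
  have h0 : ∃ u, F.AdmLip R u := by
    refine F.exists_admLip R fun k _ => ?_
    rw [hRdef]
    have h5 : 0 ≤ (1 + ε₀) ^ ((5 : ℝ) * k / 2) := Real.rpow_nonneg hε.le _
    have h6 : 0 ≤ (1 + ε₀) ^ ((5 : ℝ) * ((k : ℝ) - 1) / 2) := Real.rpow_nonneg hε.le _
    have hAk := hA0 k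
    have hAk1 := hA0 (k + 1)
    have hAkm := hA0 (k - 1)
    exact mul_nonneg (mul_nonneg (pow_nonneg (Nat.cast_nonneg m) 2) hMα)
      (add_nonneg (mul_nonneg h5 (add_nonneg (mul_nonneg hAk hAk) (mul_nonneg zero_le_two (mul_nonneg hAk hAk1))))
        (mul_nonneg h6 (mul_nonneg hAkm hAkm)))
  exact F.exists_surviving_dssWave_of_windowCert_v6 cert R A vmax χbm χem hε hΛ1 hMα hα hW1 hq hq1 hA0 hAwin
    hRdef hg0 hη hĝ0 hĝgHi hWedge hγedge hZedge hDedge hqX hDwin0 hγ0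
    hθ hβ1 hβθ hβΛ hω hδ' hβge hr₀ hκ hc hQ hσξ hwtW htubeRW htubeCW hAW
    hϑ0 hϑ1 hϑR hϑRϑ hϑRΛ hωt hAlast hεab hwtT htubeRT htubeCT hAT
    hfirstW hfirstWS hfirstT hfirstTS hrowB hrowT hrow1 h0 hwinIn hA1 hg hQA hne

end OneShiftFrame

end DSSOneShift

end Summit.NavierStokesRegularity.NavierStokesRegularity.Theorems
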